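/-
COR-CM (cell pub-hodgecm2, stage 2 of the Hodge ladder) — count-neutral KERNEL COMBINATORICS «the binary tetrahedral group SL(2,3)», part V: EQUIVARIANCE of gen 44ʼs
functionals under the sheared translation (seat prover-pub-hodgecm2-b23-g53-0, binder prover b23, gen 53; claim HOME/INBOX.md l.24246, NAME ASK l.24300).
Theorems only — gen 45ʼs `Census/OcticProductEquivariance.lean` for the motion `twA σ` of part IV instead of `twZ ζ`; on gen 44ʼs `Census/QuarticInversionValues`
BY NAME; no `decide` beyond closed identities in `Fin 4`, no certificate, no named fact, no `sorry`.  `Interfaces.lean` (C1), every E term, B01, `Transposition/*`,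
`PortJoin/*`, `D2Bridge/*` untouched.  HONEST FRAMING: `HC_CM` is NOT proved, here or anywhere in the tree; nothing here is a period, a count of record or a headline.
T5: n/a-class (no hypothesis binders beyond `Odd |A|`); checker: self.
-/
import Summits.HodgeConjecture.CorCM.Census.QuarticInversionValues
import Summits.HodgeConjecture.CorCM.Census.BinaryTetrahedralModel

/-!
# The binary tetrahedral group, V: gen 44ʼs functionals under the sheared translation

For the motion `twA σ` of part IV (`Census/BinaryTetrahedralModel.lean`): `fnl w (a·v) = fnl (w ∘ twA σ) v`; the coordinates, halves, the weights `wUp`,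
`wMatch`, `wA`, `wC` of gen 44ʼs part VII move by the coordinate rotation `ρA`/`σA`, the pattern map `η ↦ η ∘ σA` and the slot shift `s ↦ s + σ` — with
NO conjugation mask (the sheared translation commutes with `conj₄` and never complements a coordinate); hence the values on `a`-translates
(`fnl_wA_translA`, `fnl_wC_translA`, `fnl_wUp_translA`) and the transport of slot binomials: **`Avec (a·v) = binVec (σA j) (h ∘ ρA) (h' ∘ ρA) (u − σ)`
whenever `Avec v = binVec j h h' u`** (`Avec_translA_of_binVec`).  All [folklore] bookkeeping over [Pohlmann1968, Thm 1].

## References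
* [Pohlmann1968] H. Pohlmann, Algebraic cycles on abelian varieties of complex multiplication type, Ann. of Math. 88 (1968), Thm 1.
-/

namespace Summit.HodgeConjecture.CorCM.Census.BinaryTetrahedral

open Finset
open Summit.HodgeConjecture.CorCM.Census.OddSliceFacesModel
open Summit.HodgeConjecture.CorCM.Census.QuarticInversion

noncomputable section

variable (A : Type) [AddCommGroup A] [Fintype A] [DecidableEq A]

/-! ## §1 Functionals, coordinates and halves under the sheared translation -/

/-- **`fnl w (a·v) = fnl (w ∘ a) v`.** [folklore] -/
theorem fnl_translA (σ : A) (w v : Ty₄ A → ℤ) : fnl A w (translA A σ v) = fnl A (w ∘ twA A σ) v := by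
  rw [fnl_apply, fnl_apply]
  refine Fintype.sum_equiv (twAEquiv A σ).symm _ _ fun Θ => ?_
  show v (twAinv A σ Θ) * (w Θ - w (conj₄ A Θ)) =
    v (twAinv A σ Θ) * (w (twA A σ (twAinv A σ Θ)) - w (twA A σ (conj₄ A (twAinv A σ Θ))))
  rw [twA_conj₄, twA_twAinv]

omit [DecidableEq A] in
/-- **`wUp` after `a`**: coordinate `ρA j`, slot `s + σ`, no mask. [folklore] -/
theorem wUp_twA (σ : A) (j : Fin 4) (s : A) (Θ : Ty₄ A) : wUp A j s (twA A σ Θ) = wUp A (ρA j) (s + σ) Θ := by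
  unfold wUp
  rw [half_coord_twA, coord_twA]
  simp only [tw, add_zero]

omit [DecidableEq A] in
/-- **`wMatch` after `a`**: coordinate `ρA j`, pattern `η ∘ σA`. [folklore] -/
theorem wMatch_twA (σ : A) (j : Fin 4) (η : Fin 4 → Bool) (Θ : Ty₄ A) : wMatch A j η (twA A σ Θ) = wMatch A (ρA j) (η ∘ σA) Θ := by
  unfold wMatch
  have key : (∀ i, i ≠ j → half A (coord A i (twA A σ Θ)) = η i) ↔ (∀ i, i ≠ ρA j → half A (coord A i Θ) = (η ∘ σA) i) := by
    constructor
    · intro H i hi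
      have hne : σA i ≠ j := fun e => hi (by rw [← e, ρA_σA])
      have := H (σA i) hne
      rwa [half_coord_twA, ρA_σA] at this
    · intro H i hi
      have hne : ρA i ≠ ρA j := fun e => hi (by rw [← σA_ρA i, e, σA_ρA])
      have := H (ρA i) hne
      rw [half_coord_twA, this]
      show η (σA (ρA i)) = η i
      rw [σA_ρA]
  simp only [key]

omit [DecidableEq A] in
/-- **The atom weight moved by `a`**: `wA j η s (a·Θ) = wA (ρA j) (η ∘ σA) (s + σ) Θ`. [folklore] -/
theorem wA_twA (σ : A) (j : Fin 4) (η : Fin 4 → Bool) (s : A) (Θ : Ty₄ A) :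
    wA A j η s (twA A σ Θ) = wA A (ρA j) (η ∘ σA) (s + σ) Θ := by
  unfold wA
  rw [wMatch_twA, wUp_twA]

omit [DecidableEq A] in
/-- **The constant weight moved by `a`**: `wC η (a·Θ) = wC (η ∘ σA) Θ`. [folklore] -/
theorem wC_twA (σ : A) (η : Fin 4 → Bool) (Θ : Ty₄ A) : wC A η (twA A σ Θ) = wC A (η ∘ σA) Θ := by
  unfold wC
  have key : (∀ i, half A (coord A i (twA A σ Θ)) = η i) ↔ (∀ i, half A (coord A i Θ) = (η ∘ σA) i) := by
    constructor
    · intro H i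
      have := H (σA i)
      rwa [half_coord_twA, ρA_σA] at this
    · intro H i
      rw [half_coord_twA, H (ρA i)]
      show η (σA (ρA i)) = η i
      rw [σA_ρA]
  simp only [key]

/-! ## §2 Values on `a`-translates -/

/-- **Atom values on an `a`-translate.** [folklore] -/
theorem fnl_wA_translA (σ : A) (j : Fin 4) (η : Fin 4 → Bool) (s : A) (v : Ty₄ A → ℤ) :
    fnl A (wA A j η s) (translA A σ v) = fnl A (wA A (ρA j) (η ∘ σA) (s + σ)) v := by
  have hw : (wA A j η s ∘ twA A σ) = wA A (ρA j) (η ∘ σA) (s + σ) := by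
    funext Θ; simp only [Function.comp, wA_twA]
  rw [fnl_translA, hw]

/-- **Constant values on an `a`-translate.** [folklore] -/
theorem fnl_wC_translA (σ : A) (η : Fin 4 → Bool) (v : Ty₄ A → ℤ) :
    fnl A (wC A η) (translA A σ v) = fnl A (wC A (η ∘ σA)) v := by
  have hw : (wC A η ∘ twA A σ) = wC A (η ∘ σA) := by
    funext Θ; simp only [Function.comp, wC_twA]
  rw [fnl_translA, hw]

/-- **`fnl (wUp j s) (a·v) = fnl (wUp (ρA j) (s + σ)) v`.** [folklore] -/
theorem fnl_wUp_translA (σ : A) (j : Fin 4) (s : A) (v : Ty₄ A → ℤ) :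
    fnl A (wUp A j s) (translA A σ v) = fnl A (wUp A (ρA j) (s + σ)) v := by
  have hw : (wUp A j s ∘ twA A σ) = wUp A (ρA j) (s + σ) := by
    funext Θ; simp only [Function.comp, wUp_twA]
  rw [fnl_translA, hw]

/-! ## §3 Transport of slot binomials by the sheared translation -/

omit [AddCommGroup A] [Fintype A] [DecidableEq A] in
/-- The indicator under the coordinate rotation: `[η ∘ σA = h off j] = [η = h ∘ ρA off σA j]`. [folklore] -/
theorem ind₁_comp_σA (j : Fin 4) (h η : Fin 4 → Bool) : ind₁ j h (η ∘ σA) = ind₁ (σA j) (h ∘ ρA) η := by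
  unfold ind₁
  have key : (∀ n, n ≠ j → (η ∘ σA) n = h n) ↔ (∀ n, n ≠ σA j → η n = (h ∘ ρA) n) := by
    constructor
    · intro H n hn
      have hne : ρA n ≠ j := fun e => hn (by rw [← e, σA_ρA])
      have := H (ρA n) hne
      simp only [Function.comp, σA_ρA] at this
      exact this
    · intro H n hn
      have hne : σA n ≠ σA j := fun e => hn (σA_injective e)
      have := H (σA n) hne
      simp only [Function.comp, ρA_σA] at this
      exact this
  simp only [key]

/-- **Transport by `a`**: coordinate `σA j`, patterns `h ∘ ρA`, slot `u − σ`; no mask. [folklore] -/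
theorem Avec_translA_of_binVec (σ : A) {v : Ty₄ A → ℤ} {j : Fin 4} {h h' : Fin 4 → Bool} {u : A}
    (hv : Avec A v = binVec A j h h' u) : Avec A (translA A σ v) = binVec A (σA j) (h ∘ ρA) (h' ∘ ρA) (u - σ) := by
  funext i
  rcases i with ⟨j', η, s⟩ | η
  · rw [Avec_inl, fnl_wA_translA, ← Avec_inl, hv, binVec_inl, binVec_inl]
    have hj : (ρA j' = j) ↔ (j' = σA j) := by
      constructor
      · intro e; rw [← e, σA_ρA]
      · intro e; rw [e, ρA_σA]
    have hs : (s + σ = u) ↔ (s = u - σ) := eq_sub_iff_add_eq.symm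
    by_cases hc : ρA j' = j ∧ s + σ = u
    · obtain ⟨hc1, hc2⟩ := hc
      rw [if_pos ⟨hc1, hc2⟩, if_pos ⟨hj.mp hc1, hs.mp hc2⟩, ← hc1, ind₁_comp_σA, ind₁_comp_σA, σA_ρA]
    · rw [if_neg hc, if_neg (fun ⟨e1, e2⟩ => hc ⟨hj.mpr e1, hs.mpr e2⟩)]
  · rw [Avec_inr, fnl_wC_translA, ← Avec_inr, hv, binVec_inr, binVec_inr]

end

end Summit.HodgeConjecture.CorCM.Census.BinaryTetrahedral
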